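import Summits.AtomisticToContinuum.HydrodynamicLimit.Theses.BallwiseInvariantReferences

/-!
# Route BallwiseInvariantReferences — the pure-logic `Assembly` item (stmt-AtomisticToContinuum-13024)

`Assembly` is, by construction of the route, literally the type of the route's deciding theorem
`closes`:

  `LocalFluxGibbsianity → EnergyCurrentTails → FastCollisionThroughput → BallwiseSufficiency →
   EntropyToFields → _root_.HydrodynamicLimit`.

Proof (pure logic, no analytic content): the ball-wise sufficiency theorem `BallwiseSufficiency`
(stmt-AtomisticToContinuum-13023, itself the implication `LocalFluxGibbsianity → EnergyCurrentTails →
FastCollisionThroughput → RelEntropyVanishing`) applied to the three cruxes gives the shared entropy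
target `RelEntropyVanishing` (stmt-AtomisticToContinuum-0766), and the entropy-inequality glue
`EntropyToFields` (stmt-AtomisticToContinuum-0769, `RelEntropyVanishing →
Literature.MathematicalPhysics.KineticTheory.HydrodynamicLimit`) yields the (unguarded) Literature
statement, which implies the sub-problem statement `_root_.HydrodynamicLimit` — since the statement
re-type of 2026-08-16 (D-0032, p126922) the PACKING-GUARDED conjunct (outermost `∃ η₀ > 0`, guard
`∀ t ∈ [0,T), ∀ x, ρ_t(x) σ³ < η₀`); formerly an `abbrev` of the Literature statement — by
`HydrodynamicLimit.of_unguarded` (take `η₀ := 1`, ignore the guard). This is the term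
`fun h₁ h₂ h₃ h₄ h₅ => HydrodynamicLimit.of_unguarded (h₅ (h₄ h₁ h₂ h₃))` of the route's `closes`
(rev of 2026-08-16T23:49Z; dependency-drift repair of this file 2026-08-17: the two proofs below that end
in the Literature statement gained the `of_unguarded` step, statements unchanged).

Also recorded, sorry-free: the two obvious shortcuts `assembly_of_relEntropyVanishing`
(a direct proof of the shared target 0766 closes the frame through `EntropyToFields`, the three
cruxes and `BallwiseSufficiency` then being idle) and `assembly_of_hydrodynamicLimit` (the frame is
implied by its own conclusion). Nothing here discharges any of the five antecedents.
-/

namespace Summit.AtomisticToContinuum.HydrodynamicLimit.Theorems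

open Summit.AtomisticToContinuum.HydrodynamicLimit.Theses in
/-- The `Assembly` item of route BallwiseInvariantReferences (stmt-AtomisticToContinuum-13024),
pure logic: the cruxes `LocalFluxGibbsianity`, `EnergyCurrentTails`, `FastCollisionThroughput`,
the sufficiency implication `BallwiseSufficiency` and the glue `EntropyToFields` imply the
sub-problem statement `HydrodynamicLimit` — `BallwiseSufficiency` turns the three cruxes into
`RelEntropyVanishing`, `EntropyToFields` turns that into
`Literature.MathematicalPhysics.KineticTheory.HydrodynamicLimit`, and the packing-guarded
`_root_.HydrodynamicLimit` follows by `HydrodynamicLimit.of_unguarded`.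
[cite: Yau1991, §2] [cite: OllaVaradhanYau1993, Thm 1.1] -/
theorem ballwiseInvariantReferences_assembly_proof :
    Summit.AtomisticToContinuum.HydrodynamicLimit.Theses.BallwiseInvariantReferences.Assembly := by
  unfold BallwiseInvariantReferences.Assembly
  intro h₁ h₂ h₃ h₄ h₅
  exact _root_.HydrodynamicLimit.of_unguarded (h₅ (h₄ h₁ h₂ h₃))

open Summit.AtomisticToContinuum.HydrodynamicLimit.Theses in
/-- **The entropy target closes the frame.** If the shared typed target
`BallwiseInvariantReferences.RelEntropyVanishing` (stmt-AtomisticToContinuum-0766: `o(N)` relative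
entropy of the law at time `t` with respect to a reference local Gibbs law whose fields concentrate
exponentially around the Euler fields) holds outright, then `Assembly` holds with its first four
antecedents idle, through the glue hypothesis `EntropyToFields` (and `HydrodynamicLimit.of_unguarded`
for the packing guard). [cite: Yau1991, §2] -/
theorem ballwiseInvariantReferences_assembly_of_relEntropyVanishing
    (hRE : BallwiseInvariantReferences.RelEntropyVanishing) :
    Summit.AtomisticToContinuum.HydrodynamicLimit.Theses.BallwiseInvariantReferences.Assembly := by
  unfold BallwiseInvariantReferences.Assembly
  intro _ _ _ _ h₅
  exact _root_.HydrodynamicLimit.of_unguarded (h₅ hRE)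

open Summit.AtomisticToContinuum.HydrodynamicLimit.Theses in
/-- **The conclusion closes the frame.** `Assembly` is an implication whose conclusion is the
sub-problem statement `_root_.HydrodynamicLimit`; if that statement holds (by whatever route), the
frame holds with all five antecedents idle. [folklore] -/
theorem ballwiseInvariantReferences_assembly_of_hydrodynamicLimit (h : _root_.HydrodynamicLimit) :
    Summit.AtomisticToContinuum.HydrodynamicLimit.Theses.BallwiseInvariantReferences.Assembly := by
  unfold BallwiseInvariantReferences.Assembly
  intro _ _ _ _ _
  exact h

end Summit.AtomisticToContinuum.HydrodynamicLimit.Theorems
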